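import Summits.HodgeConjecture.CorCM.TwoGroupInvertedCyclicEightTable
import HarnessLib

/-!
# `C₈ × C₂` of index two: exponent bookkeeping for the three actions (inversion, shear, inversion·shear)

COR-CM (cell `pub-hodgecm2`), binder seat b04 (gen 36), count-neutral own lane «Galois-CM-type classification».  KERNEL ONLY, pure
group theory: theorems; no definition, no named fact, no `sorry`.  Sequel of `CorCM/TwoGroupInvertedCyclicEightTable`; the
elementary identities consumed by the B2 branch of the order-`32` base (`CorCM/GaloisThirtyTwoOrderEightBranch`).

SETTING.  `|G| = 32`, `r` of order `8`, `t` a central involution with `t ∉ ⟨r⟩`; an element `x` not commuting with `r` acts on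
`A = C(r) = {rⁱ tʲ}` by one of `r ↦ r⁻¹` (inversion), `r ↦ r t` (shear), `r ↦ r⁻¹ t`.

* `exists_not_comm_of_order_eight` — if `G` is not abelian, some `x` does not commute with `r` (else `Z(G) ⊇ ⟨r, t⟩` has index `≤ 2`).
* `pow_four_eq_of_comm` — an element `rⁱ tʲ` with `(rⁱ tʲ)⁴ ≠ 1` has `i` odd and `(rⁱ tʲ)⁴ = r⁴`; `conj_of_inv/shear/invshear` — its
  conjugate by `x` is `(rⁱtʲ)⁻¹`, `(rⁱtʲ) t`, `(rⁱtʲ)⁻¹ t` respectively.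
* `sq_eq_of_inv` — for the inversion action `x² = rᵃ tᵇ` with `a ∈ {0, 4}`; `pow_four_eq_one_of_inv`, `pow_four_eq_one_of_invshear`
  — for the actions `r ↦ r⁻¹`, `r ↦ r⁻¹t` the acting element has `x⁴ = 1`; `conj_eq_mul_of_shear` — for the shear, `r⁻¹ x r = x t`.

## References

* [Rotman1995] J. J. Rotman, *An Introduction to the Theory of Groups*, 4th ed., GTM 148, §5 (context).
-/

namespace Summit.HodgeConjecture.CorCM.GaloisModels.CyclicEight

open Summit.HodgeConjecture.CorCM.GaloisTableLaws

variable {G : Type*} [Group G]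

/-! ## §1 Powers -/

/-- `r⁸ = 1`, `i` odd ⟹ `r^{4i} = r⁴`. [folklore] -/
theorem pow_four_mul_odd {r : G} (hr8 : r ^ 8 = 1) {i : ℕ} (hi : Odd i) : r ^ (4 * i) = r ^ 4 := by
  obtain ⟨m, rfl⟩ := hi
  rw [show 4 * (2 * m + 1) = 8 * m + 4 by ring, pow_add, pow_mul, hr8, one_pow, one_mul]

/-- `r⁸ = 1`, `i` even ⟹ `r^{4i} = 1`. [folklore] -/
theorem pow_four_mul_even {r : G} (hr8 : r ^ 8 = 1) {i : ℕ} (hi : Even i) : r ^ (4 * i) = 1 := by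
  obtain ⟨m, rfl⟩ := hi
  rw [show 4 * (m + m) = 8 * m by ring, pow_mul, hr8, one_pow]

/-- `t² = 1`, `i` odd ⟹ `tⁱ = t`. [folklore] -/
theorem invol_pow_odd {t : G} (htt : t * t = 1) {i : ℕ} (hi : Odd i) : t ^ i = t := by
  obtain ⟨m, rfl⟩ := hi
  rw [pow_add, pow_mul, pow_two, htt, one_pow, one_mul, pow_one]

/-- `t² = 1`, `i` even ⟹ `tⁱ = 1`. [folklore] -/
theorem invol_pow_even {t : G} (htt : t * t = 1) {i : ℕ} (hi : Even i) : t ^ i = 1 := by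
  obtain ⟨m, rfl⟩ := hi
  rw [← two_mul, pow_mul, pow_two, htt, one_pow]

/-- **Fourth powers in `⟨r⟩ × ⟨t⟩`**: `(rⁱ tʲ)⁴ = r^{4i}`; if it is `≠ 1` then `i` is odd and it equals `r⁴`. [folklore] -/
theorem pow_four_eq_of_comm {r t : G} (hr8 : r ^ 8 = 1) (htt : t * t = 1) (hrt : r * t = t * r) (i j : ℕ)
    (h4 : (r ^ i * t ^ j) ^ 4 ≠ 1) : Odd i ∧ (r ^ i * t ^ j) ^ 4 = r ^ 4 := by
  have hc : Commute (r ^ i) (t ^ j) := (show Commute r t from hrt).pow_pow i j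
  have h1 : (r ^ i * t ^ j) ^ 4 = r ^ (4 * i) := by
    rw [hc.mul_pow, ← pow_mul, ← pow_mul, mul_comm i 4, mul_comm j 4,
      invol_pow_even htt (show Even (4 * j) from ⟨2 * j, by ring⟩), mul_one]
  rcases Nat.even_or_odd i with hi | hi
  · exact absurd (h1.trans (pow_four_mul_even hr8 hi)) h4
  · exact ⟨hi, h1.trans (pow_four_mul_odd hr8 hi)⟩

/-- The inverse of `rⁱ tʲ` is `(rⁱ)⁻¹ tʲ`. [folklore] -/
theorem inv_pow_mul_pow {r t : G} (htt : t * t = 1) (hrt : r * t = t * r) (i j : ℕ) :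
    (r ^ i * t ^ j)⁻¹ = (r ^ i)⁻¹ * t ^ j := by
  have htinv : (t ^ j)⁻¹ = t ^ j := by
    rw [inv_eq_iff_mul_eq_one, ← pow_add, ← two_mul, pow_mul, pow_two, htt, one_pow]
  rw [mul_inv_rev, htinv, (((show Commute r t from hrt).pow_pow i j).inv_left).eq]

/-! ## §2 Conjugates of the elements of `⟨r⟩ × ⟨t⟩` under the three actions -/

/-- Inversion: `x r x⁻¹ = r⁻¹` ⟹ `x (rⁱtʲ) x⁻¹ = (rⁱtʲ)⁻¹`. [folklore] -/
theorem conj_of_inv {r t x : G} (htt : t * t = 1) (hrt : r * t = t * r) (hxr : x * r * x⁻¹ = r⁻¹) (hxt : x * t = t * x)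
    (i j : ℕ) : x * (r ^ i * t ^ j) * x⁻¹ = (r ^ i * t ^ j)⁻¹ := by
  rw [inv_pow_mul_pow htt hrt, show x * (r ^ i * t ^ j) * x⁻¹ = (x * r ^ i * x⁻¹) * (x * t ^ j * x⁻¹) by group,
    ← conj_pow, hxr, inv_pow, ← conj_pow, show x * t * x⁻¹ = t by rw [hxt, mul_inv_cancel_right]]

/-- Shear: `x r x⁻¹ = r t` ⟹ `x (rⁱtʲ) x⁻¹ = (rⁱtʲ) tⁱ`. [folklore] -/
theorem conj_of_shear {r t x : G} (hrt : r * t = t * r) (hxr : x * r * x⁻¹ = r * t) (hxt : x * t = t * x) (i j : ℕ) :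
    x * (r ^ i * t ^ j) * x⁻¹ = r ^ i * t ^ j * t ^ i := by
  rw [show x * (r ^ i * t ^ j) * x⁻¹ = (x * r ^ i * x⁻¹) * (x * t ^ j * x⁻¹) by group, ← conj_pow, hxr,
    (show Commute r t from hrt).mul_pow, ← conj_pow, show x * t * x⁻¹ = t by rw [hxt, mul_inv_cancel_right]]
  rw [mul_assoc, mul_assoc, ← pow_add, ← pow_add, add_comm]

/-- Inversion·shear: `x r x⁻¹ = r⁻¹ t` ⟹ `x (rⁱtʲ) x⁻¹ = (rⁱtʲ)⁻¹ tⁱ`. [folklore] -/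
theorem conj_of_invshear {r t x : G} (htt : t * t = 1) (hrt : r * t = t * r) (hxr : x * r * x⁻¹ = r⁻¹ * t)
    (hxt : x * t = t * x) (i j : ℕ) : x * (r ^ i * t ^ j) * x⁻¹ = (r ^ i * t ^ j)⁻¹ * t ^ i := by
  have hrt' : Commute r⁻¹ t := (show Commute r t from hrt).inv_left
  rw [inv_pow_mul_pow htt hrt, show x * (r ^ i * t ^ j) * x⁻¹ = (x * r ^ i * x⁻¹) * (x * t ^ j * x⁻¹) by group,
    ← conj_pow, hxr, hrt'.mul_pow, ← conj_pow, show x * t * x⁻¹ = t by rw [hxt, mul_inv_cancel_right], inv_pow]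
  rw [mul_assoc, mul_assoc, ← pow_add, ← pow_add, add_comm]

/-! ## §3 The acting element -/

variable [Finite G]

/-- **If `G` is not abelian, some `x` fails to commute with `r`** (`|G| = 32`, `orderOf r = 8`, `t` central, `t ∉ ⟨r⟩`): otherwise the
sixteen elements `rⁱ tʲ` are central, `Z(G)` has index `≤ 2`, and `G` is abelian. [folklore] -/
theorem exists_not_comm_of_order_eight (hcard : Nat.card G = 32) {r t : G} (hr : orderOf r = 8)
    (htr : t ∉ Subgroup.zpowers r) (htcen : ∀ g : G, g * t = t * g) (hnab : ∃ g h : G, g * h ≠ h * g) :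
    ∃ x : G, x * r ≠ r * x := by
  classical
  by_contra hall
  push Not at hall
  obtain ⟨g₀, h₀, hgh⟩ := hnab
  apply hgh
  set Z := Subgroup.center G with hZ
  -- sixteen distinct central elements
  have hmem : ∀ p : ZMod 8 × ZMod 2, r ^ p.1.val * t ^ p.2.val ∈ Z := fun p => by
    rw [hZ, Subgroup.mem_center_iff]
    intro g
    exact ((((show Commute r g from (hall g).symm).pow_left _).mul_left ((show Commute t g from (htcen g).symm).pow_left _)).eq).symm
  set f : ZMod 8 × ZMod 2 → Z := fun p => ⟨r ^ p.1.val * t ^ p.2.val, hmem p⟩ with hf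
  have ht' : ∀ i i' : ℕ, r ^ i * t = r ^ i' → False := by
    intro i i' h
    apply htr
    have : t = (r ^ i)⁻¹ * r ^ i' := by rw [← h, inv_mul_cancel_left]
    rw [this]
    exact Subgroup.mul_mem _ (Subgroup.inv_mem _ (Subgroup.pow_mem _ (Subgroup.mem_zpowers r) i))
      (Subgroup.pow_mem _ (Subgroup.mem_zpowers r) i')
  have hinj : Function.Injective f := by
    rintro ⟨i, j⟩ ⟨i', j'⟩ h
    simp only [hf, Subtype.mk.injEq] at h
    have hi : ∀ {i i' : ZMod 8}, r ^ i.val = r ^ i'.val → i = i' := by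
      intro i i' h
      rw [pow_inj_mod, hr, Nat.mod_eq_of_lt (ZMod.val_lt i), Nat.mod_eq_of_lt (ZMod.val_lt i')] at h
      exact ZMod.val_injective 8 h
    rcases zmod2_cases j with rfl | rfl <;> rcases zmod2_cases j' with rfl | rfl
    · simp only [ZMod.val_zero, pow_zero, mul_one] at h
      rw [hi h]
    · simp only [ZMod.val_zero, pow_zero, mul_one, show (1 : ZMod 2).val = 1 from rfl, pow_one] at h
      exact (ht' _ _ h.symm).elim
    · simp only [ZMod.val_zero, pow_zero, mul_one, show (1 : ZMod 2).val = 1 from rfl, pow_one] at h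
      exact (ht' _ _ h).elim
    · simp only [show (1 : ZMod 2).val = 1 from rfl, pow_one] at h
      rw [hi (mul_right_cancel h)]
  have hZ16 : 16 ≤ Nat.card Z := by
    have := Nat.card_le_card_of_injective f hinj
    rw [Nat.card_prod, Nat.card_zmod, Nat.card_zmod] at this
    exact this
  have hidx : Z.index = 1 ∨ Z.index = 2 := by
    have h1 := Z.card_mul_index
    rw [hcard] at h1
    have h0 : Z.index ≠ 0 := Subgroup.index_ne_zero_of_finite
    have : Z.index ≤ 2 := by nlinarith [hZ16, h1]
    omega
  rcases hidx with h1 | h2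
  · have htop : Z = ⊤ := Subgroup.index_eq_one.1 h1
    have hg : g₀ ∈ Subgroup.center G := by rw [← hZ, htop]; exact Subgroup.mem_top _
    exact ((Subgroup.mem_center_iff.1 hg) h₀).symm
  · haveI : Fact (Nat.Prime 2) := ⟨Nat.prime_two⟩
    haveI : IsCyclic (G ⧸ Subgroup.center G) := by
      apply isCyclic_of_prime_card (p := 2)
      rw [← Subgroup.index_eq_card, ← hZ, h2]
    haveI := MonoidHom.isMulCommutative_of_isCyclic_of_ker_le_center (QuotientGroup.mk' (Subgroup.center G))
      (by rw [QuotientGroup.ker_mk'])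
    exact IsMulCommutative.is_comm.comm g₀ h₀

/-- **The square of an inverting element**: `x r x⁻¹ = r⁻¹`, `x t = t x` ⟹ `x² = rᵃ tᵇ` with `a ∈ {0, 4}`, `b < 2` (`x²` commutes with
`r` and is fixed by `x`). [folklore] -/
theorem sq_eq_of_inv (hcard : Nat.card G = 32) {r t x : G} (hr : orderOf r = 8) (htt : t * t = 1)
    (htr : t ∉ Subgroup.zpowers r) (hrt : r * t = t * r) (hxr : x * r * x⁻¹ = r⁻¹) (hxt : x * t = t * x) :
    ∃ a b : ℕ, (a = 0 ∨ a = 4) ∧ b < 2 ∧ x * x = r ^ a * t ^ b := by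
  have hr8 : r ^ 8 = 1 := by rw [← hr]; exact pow_orderOf_eq_one r
  have hx : x * r ≠ r * x := by
    intro h
    rw [h, mul_inv_cancel_right] at hxr
    have h2 : r * r = 1 := mul_eq_one_iff_eq_inv.2 hxr
    have := orderOf_dvd_of_pow_eq_one (show r ^ 2 = 1 by rw [pow_two, h2])
    rw [hr] at this; omega
  -- `x²` commutes with `r`
  have hsq : x * x * r = r * (x * x) := by
    have h1 : x * r = r⁻¹ * x := by rw [← hxr, inv_mul_cancel_right]
    have h2 : x * r⁻¹ = r * x := by
      rw [← inv_inj, mul_inv_rev, inv_inv, mul_inv_rev, eq_inv_mul_iff_mul_eq, ← mul_assoc, h1, mul_assoc,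
        mul_inv_cancel, mul_one]
    rw [mul_assoc, h1, ← mul_assoc, h2, mul_assoc]
  obtain ⟨a, b, ha, hb, hab⟩ := exists_pow_mul_pow_of_comm hcard hr htr hrt hx (x * x) hsq
  refine ⟨a, b, ?_, hb, hab⟩
  -- `x x² x⁻¹ = x²` and `x (rᵃ tᵇ) x⁻¹ = (rᵃ)⁻¹ tᵇ`
  have h1 : x * (r ^ a * t ^ b) * x⁻¹ = (r ^ a)⁻¹ * t ^ b := by rw [conj_of_inv htt hrt hxr hxt, inv_pow_mul_pow htt hrt]
  have h2 : x * (r ^ a * t ^ b) * x⁻¹ = r ^ a * t ^ b := by rw [← hab]; group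
  rw [h2] at h1
  have h3 : r ^ a * r ^ a = 1 := by
    have h4 : (r ^ a)⁻¹ = r ^ a := (mul_right_cancel h1).symm
    calc r ^ a * r ^ a = (r ^ a)⁻¹ * r ^ a := by rw [h4]
      _ = 1 := inv_mul_cancel (r ^ a)
  rw [← pow_add] at h3
  have hdvd := orderOf_dvd_of_pow_eq_one h3
  rw [hr] at hdvd
  omega

omit [Finite G] in
/-- The square of `rᵃ tᵇ` is `r^{2a}`. [folklore] -/
theorem sq_pow_mul_pow {r t : G} (htt : t * t = 1) (hrt : r * t = t * r) (a b : ℕ) :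
    r ^ a * t ^ b * (r ^ a * t ^ b) = r ^ (a + a) := by
  calc r ^ a * t ^ b * (r ^ a * t ^ b) = r ^ a * (t ^ b * r ^ a) * t ^ b := by simp only [mul_assoc]
    _ = r ^ a * (r ^ a * t ^ b) * t ^ b := by rw [(((show Commute r t from hrt).pow_pow a b).symm).eq]
    _ = r ^ (a + a) * (t ^ b * t ^ b) := by rw [pow_add]; simp only [mul_assoc]
    _ = r ^ (a + a) := by rw [← pow_add, invol_pow_even htt ⟨b, rfl⟩, mul_one]

/-- **Inversion action ⟹ `x⁴ = 1`**: an element acting on `r` by inversion never has order `8`. [folklore] -/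
theorem pow_four_eq_one_of_inv (hcard : Nat.card G = 32) {r t x : G} (hr : orderOf r = 8) (htt : t * t = 1)
    (htr : t ∉ Subgroup.zpowers r) (hrt : r * t = t * r) (hxr : x * r * x⁻¹ = r⁻¹) (hxt : x * t = t * x) : x ^ 4 = 1 := by
  have hr8 : r ^ 8 = 1 := by rw [← hr]; exact pow_orderOf_eq_one r
  obtain ⟨a, b, ha, -, hab⟩ := sq_eq_of_inv hcard hr htt htr hrt hxr hxt
  rw [show x ^ 4 = (x * x) * (x * x) by simp only [pow_succ, pow_zero, one_mul, mul_assoc], hab, sq_pow_mul_pow htt hrt]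
  rcases ha with rfl | rfl
  · exact pow_zero r
  · exact hr8

/-- **Inversion·shear action ⟹ `x⁴ = 1`**: `x r x⁻¹ = r⁻¹ t` forces `x² = rᵃ tᵇ` with `a` even and `r^{2a} = 1`. [folklore] -/
theorem pow_four_eq_one_of_invshear (hcard : Nat.card G = 32) {r t x : G} (hr : orderOf r = 8) (htt : t * t = 1)
    (htr : t ∉ Subgroup.zpowers r) (hrt : r * t = t * r) (hxr : x * r * x⁻¹ = r⁻¹ * t) (hxt : x * t = t * x) :
    x ^ 4 = 1 := by
  have hx : x * r ≠ r * x := by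
    intro h
    rw [h, mul_inv_cancel_right] at hxr
    apply htr
    -- `r = r⁻¹ t` ⟹ `r r = t`
    have h2 : r * r = t := (congrArg (r * ·) hxr).trans (mul_inv_cancel_left r t)
    rw [← h2]
    exact Subgroup.mul_mem _ (Subgroup.mem_zpowers r) (Subgroup.mem_zpowers r)
  -- `x²` commutes with `r`
  have hsq : x * x * r = r * (x * x) := by
    have h1 : x * r = r⁻¹ * t * x := by rw [← hxr, inv_mul_cancel_right]
    have h2 : x * r⁻¹ = t * r * x := by
      have : x * r⁻¹ * x⁻¹ = (r⁻¹ * t)⁻¹ := by rw [← hxr]; group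
      rw [mul_inv_rev, inv_inv, inv_eq_of_mul_eq_one_right htt] at this
      rw [← this, inv_mul_cancel_right]
    calc x * x * r = x * (x * r) := mul_assoc _ _ _
      _ = x * (r⁻¹ * t * x) := by rw [h1]
      _ = (x * r⁻¹) * (t * x) := by simp only [mul_assoc]
      _ = (t * r * x) * (t * x) := by rw [h2]
      _ = t * r * (x * t) * x := by simp only [mul_assoc]
      _ = t * r * (t * x) * x := by rw [hxt]
      _ = (t * r) * t * (x * x) := by simp only [mul_assoc]
      _ = (r * t) * t * (x * x) := by rw [← hrt]
      _ = r * (t * t) * (x * x) := by simp only [mul_assoc]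
      _ = r * (x * x) := by rw [htt, mul_one]
  obtain ⟨a, b, -, -, hab⟩ := exists_pow_mul_pow_of_comm hcard hr htr hrt hx (x * x) hsq
  -- `x x² x⁻¹ = x²`: `(rᵃ)⁻¹ tᵇ tᵃ = rᵃ tᵇ`, so `tᵃ = r^{2a}`
  have h1 : x * (r ^ a * t ^ b) * x⁻¹ = (r ^ a)⁻¹ * t ^ b * t ^ a := by
    rw [conj_of_invshear htt hrt hxr hxt, inv_pow_mul_pow htt hrt]
  have h2 : x * (r ^ a * t ^ b) * x⁻¹ = r ^ a * t ^ b := by rw [← hab]; group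
  rw [h2] at h1
  -- cancel `tᵇ` (everything commutes)
  have h3 : t ^ a = r ^ a * r ^ a := by
    have hc1 : (r ^ a)⁻¹ * t ^ b * t ^ a = t ^ b * ((r ^ a)⁻¹ * t ^ a) := by
      rw [← mul_assoc, ((((show Commute r t from hrt).pow_pow a b)).inv_left).eq]
    have hc2 : r ^ a * t ^ b = t ^ b * r ^ a := (((show Commute r t from hrt).pow_pow a b)).eq
    rw [hc1, hc2] at h1
    have h4 : (r ^ a)⁻¹ * t ^ a = r ^ a := (mul_left_cancel h1).symm
    rw [inv_mul_eq_iff_eq_mul] at h4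
    exact h4
  rcases Nat.even_or_odd a with ha | ha
  · rw [invol_pow_even htt ha] at h3
    rw [show x ^ 4 = (x * x) * (x * x) by simp only [pow_succ, pow_zero, one_mul, mul_assoc], hab, sq_pow_mul_pow htt hrt,
      pow_add]
    exact h3.symm
  · exfalso
    apply htr
    rw [invol_pow_odd htt ha] at h3
    rw [h3]
    exact Subgroup.mul_mem _ (Subgroup.pow_mem _ (Subgroup.mem_zpowers r) a) (Subgroup.pow_mem _ (Subgroup.mem_zpowers r) a)

omit [Finite G] in
/-- **Shear action**: `x r x⁻¹ = r t` ⟹ `r⁻¹ x (r⁻¹)⁻¹ = x t`. [folklore] -/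
theorem conj_eq_mul_of_shear {r t x : G} (hxr : x * r * x⁻¹ = r * t) (hxt : x * t = t * x) :
    r⁻¹ * x * r⁻¹⁻¹ = x * t := by
  have h1 : x * r = r * t * x := by rw [← hxr, inv_mul_cancel_right]
  rw [inv_inv, mul_assoc, h1, hxt]
  group

end Summit.HodgeConjecture.CorCM.GaloisModels.CyclicEight
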